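import Summits.ResolutionOfSingularities.ResolutionOfSingularities.Theorems.FrobeniusClosingSteerWords19HeightSplit
import Summits.ResolutionOfSingularities.ResolutionOfSingularities.Theorems.FrobeniusClosingSteerStrippedThreadInfinitelyHit
import Summits.ResolutionOfSingularities.ResolutionOfSingularities.Theorems.FrobeniusClosingSteerCleanerDescent

/-!
# Crux `Steer` (stmt-ResolutionOfSingularities-16345), line `switching-dichotomy` — WORDS 20: §σ2.25 F-A3 adoption leaf `strippedThreadTwoN_holds` (res-D-pv-003 Θ1♭, p525514) and §σ2.26 v2 (re-cut r) PART 1 — the DERIVATION currency words (H `HasCleaningDerivations`, hB2 `DerivationStepTransfer`, (C) `CleaningExact`, K♭ v2.2 `NoEternalStrippedRadicandChainH` / `…HP`, G v2 `NoEternalConstOrderIsolatedChain` / `…Perfect` / `…Imperfect` and the pure-logic weakenings) (HOIST of the registered skeleton r49 bb092f8f650aca19, l.1096–1447, inside `section HeightSplitTwo` with its `variable {K : Type} [Field K]`)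

Holder res-L0-w41-lead-1 g6 on res-L0-w41-plan-1 RULING 47 (E1) / 104b; see `…Words01Core` for the hoist protocol (bodies byte for byte;
`[cite: …]` / `[folklore]` tags on CLOSED `def … : Prop` words are written «(ref. …)» / «(folklore)» — GATE NOTE of `…Words02Stubs`;
cite keys inside `[cite:]` tags normalised to `references.bib` keys where needed, as in `…Words03Phases`).
Nothing here is a statement of the manuscript [claim: Hironaka2017, status: under-review]. OURS (candidates / vocabulary; AI review is
weaker than expert review).
-/

open Summit.ResolutionOfSingularities.ResolutionOfSingularities.Theses.FrobeniusClosing (IsolatedForcedTermination)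
open Literature.AlgebraicGeometry.Resolution (IsAbhyankarPlace FGOver exists_ringKrullDim_eq_and_trdeg_eq
  trdeg_eq_trdeg_of_isFractionRing locAtCentre IsQuadraticTransformAlong SubringDominates IsRsopPart
  LocalUniformization3 RelLocalUniformization CossartPiltant2019General)
open Summit.ResolutionOfSingularities.ResolutionOfSingularities.Theorems.SteerRankThinness
  (HasProperCoarsening concl_of_hasProperCoarsening rankOne_of_not_hasProperCoarsening)
open Summit.ResolutionOfSingularities.ResolutionOfSingularities.Theorems.PfaffLine

set_option linter.dupNamespace false

namespace Summit.ResolutionOfSingularities.ResolutionOfSingularities.Theorems.SwitchingDichotomy.Words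

section SteeredTwo

open IsLocalRing
open Literature.AlgebraicGeometry.Resolution (IsLocalBlowupAlong IsQuadraticTransform IsExcellentRing)

variable {K : Type} [Field K]


/-! #### §σ2.25 F-A3 — `StrippedThreadTwoN` HOLDS (adoption leaf, res-D-pv-003 Θ1♭; res-L0-w41-plan-1 RULINGS 36 / 74 / 85a)

INSERTION RECIPE (holder only): (i) add the two imports
`import Summits.ResolutionOfSingularities.ResolutionOfSingularities.Theorems.FrobeniusClosingSteerStrippedThreadInfinitelyHit` and
`import Summits.ResolutionOfSingularities.ResolutionOfSingularities.Theorems.FrobeniusClosingSteerCleanerDescent`; (ii) paste this block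
right after `eternalSteeredRunTwo_of_slate6` (before `end HeightSplitTwo`). New names only: `strippedThreadTwoN_holds`,
`eternalSteeredRunTwo_of_slate6_closed`. 0 sorries in this block. Files (all ACCEPTED, `--supports 16345 --as helper`, Theses-free):
p520316 `…StrippedThreadLemmas` · p521454 `…StrippedThreadGerm` · p522759 `…StrippedThreadDivisor` (the hit lemma) · p524060
`…StrippedThreadBlock` · p524822 `…StrippedThreadChain` (engine) · p525514 `…StrippedThreadInfinitelyHit` (thread level); with
res-L0-w41-stub-4's (L2) `CleanerDescent.cleaner_descent` (p523530), res-D-pv-007's `RadicandRenorm` (p522643), res-D-pv-011's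
THREAD files (p514807/p515983/…ThreadFinitelyHit), res-type-096's `TowerHeight` (p516898) and (g2) (p502861). -/

/-- **F-A3 · `StrippedThreadTwoN` HOLDS** (adoption leaf over res-D-pv-003's Theses-free Θ1♭
`StrippedThread.exists_not_noEternalStrippedChain_of_infinitelyHit` (…Theorems.FrobeniusClosingSteerStrippedThreadInfinitelyHit, p525514,
over the engine `StrippedThread.not_noEternalStrippedChain_of_thread` p524822) with the cleaner-descent binder discharged by
res-L0-w41-stub-4's `CleanerDescent.cleaner_descent` (p523530); CoreDatum plumbing as in `finitelyHitThreadTwoN_holds`; the σ-data at a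
positive centre — prime, cleaning in `P^2`, minimality, SINGULARITY of `P` itself, regular quotient — are the four clauses of
`IsPermissibleCentre` / `IsTopSingComponent`). OURS. -/
theorem strippedThreadTwoN_holds : StrippedThreadTwoN := by
  intro p hp2 k K _ _ _ _ _ O A₀ h₀ t core _ R P s hR0 _ hrun _ _ J hJ hJA hJ2 hfin2 hinf
  subst hp2
  haveI : Fact (Nat.Prime 2) := ⟨Nat.prime_two⟩
  haveI : CharP K 2 := charP_of_injective_algebraMap (algebraMap k K).injective 2
  obtain ⟨hfg, htp, hfr, hreg, -, hzd, -, -, -, -, -, -, htr, -⟩ := core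
  have hmono : Monotone R := hrun.monotone
  obtain ⟨-, hstep⟩ := hrun
  have hsp : ∀ i, s i ^ 2 ∈ R i := fun i => by
    obtain ⟨_, hs, -⟩ := hstep i
    exact hs
  have hbl : ∀ i, IsLocalBlowupAlong O (R i) (P i) (R (i + 1)) := fun i => by
    obtain ⟨_, _, -, hbl, -⟩ := hstep i
    exact hbl
  have h0 : IsRegularLocalRing (R 0) := by
    rw [hR0]
    exact (Literature.AlgebraicGeometry.Resolution.isRegularLocalRing_locAtCentre_iff h₀).mpr hreg
  have hregR : ∀ i, IsRegularLocalRing (R i) := fun i =>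
    _root_.Summit.ResolutionOfSingularities.ResolutionOfSingularities.Theorems.SwitchingDichotomy.SteeredMembersRegular.isRegularLocalRing_steps (O := O) R P i h0 (fun j _ => by
      obtain ⟨hloc, hs, hσ, hblj, -⟩ := hstep j
      refine ⟨hloc, ?_, hblj⟩
      rcases hσ with hperm | ⟨hP, -, -⟩
      · exact Or.inl hperm.2.2.1
      · exact Or.inr hP) i le_rfl
  have hdim : ∀ i, ringKrullDim (R i) = (4 : ℕ) := fun i =>
    _root_.Summit.ResolutionOfSingularities.ResolutionOfSingularities.Theorems.SwitchingDichotomy.TailCodim.ringKrullDim_member_eq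
      k K O A₀ h₀ t two_pos hfg htp hfr hzd htr R i hR0 fun j _ => (hbl j).isLocalBlowup
  have hheight : ∀ (i m : ℕ) (hle : R i ≤ R m) (Q : Ideal (R m)) [Q.IsPrime],
      Q.height ≤ (Q.comap (Subring.inclusion hle)).height := by
    intro i m hle Q _
    by_cases him : i ≤ m
    · exact _root_.Summit.ResolutionOfSingularities.ResolutionOfSingularities.Theorems.SwitchingDichotomy.TowerHeight.height_le_height_comap_of_tower
        O A₀ h₀ hfg t 2 two_pos htp hfr R hR0 (fun j => (hbl j).isLocalBlowup) him hle Q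
    · have e : R i = R m := le_antisymm hle (hmono (le_of_not_ge him))
      have key : ∀ (A B : Subring K) (_ : A = B) (h : A ≤ B) (Q : Ideal B) [Q.IsPrime],
          Q.height ≤ (Q.comap (Subring.inclusion h)).height := by
        intro A B e h Q _
        subst e
        have hQ : Q.comap (Subring.inclusion h) = Q := by
          ext y
          rw [Ideal.mem_comap]
          rfl
        rw [hQ]
      exact key _ _ e hle Q
  have hvis : ∀ i, (∃ _ : IsLocalRing (R i), P i ≠ maximalIdeal (R i)) →
      (P i).IsPrime ∧ (∃ g : R i, (⟨s i ^ 2, hsp i⟩ : R i) - g ^ 2 ∈ P i ^ 2) ∧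
      (∀ (Q : Ideal (R i)) [Q.IsPrime], Q < P i →
        IsRegularLocalRing (AdjoinRoot ((Polynomial.X : Polynomial (Localization.AtPrime Q)) ^ 2 -
          Polynomial.C (algebraMap (R i) (Localization.AtPrime Q) ⟨s i ^ 2, hsp i⟩)))) ∧
      (∀ _ : (P i).IsPrime, ¬ IsRegularLocalRing (AdjoinRoot ((Polynomial.X : Polynomial (Localization.AtPrime (P i))) ^ 2 -
          Polynomial.C (algebraMap (R i) (Localization.AtPrime (P i)) ⟨s i ^ 2, hsp i⟩)))) ∧
      IsRegularLocalRing (R i ⧸ P i) := by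
    intro i ⟨_, hne⟩
    obtain ⟨hloc, hs, hσ, -, -⟩ := hstep i
    have hperm : IsPermissibleCentre (R i) 2 ⟨s i ^ 2, hsp i⟩ (P i) := by
      rcases hσ with hperm | ⟨hP, -, -⟩
      · exact hperm
      · exact absurd hP hne
    obtain ⟨hPi, hsing, hmc, -⟩ := hperm.2.1
    refine ⟨hPi, hperm.2.2.2, fun Q hQp hQ => ?_, fun _ => hsing, hperm.2.2.1⟩
    by_contra hnr
    exact hQ.ne (hmc Q hnr hQ.le)
  have hinf' : ∀ m₀ : ℕ, ∃ m, m₀ ≤ m ∧ m ∉ J ∧ ∃ l ∈ J, IsHitStep R P m l := by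
    intro m₀
    by_contra h
    apply hinf
    exact ⟨m₀, fun m hm hmJ l hl hhit => h ⟨m, hm, hmJ, l, hl, hhit⟩⟩
  obtain ⟨c, hc2, hcn, -, hK⟩ :=
    _root_.Summit.ResolutionOfSingularities.ResolutionOfSingularities.Theorems.SwitchingDichotomy.StrippedThread.exists_not_noEternalStrippedChain_of_infinitelyHit
      2 O A₀ h₀ hfg R P s 4 hR0 hbl (fun i => by obtain ⟨_, _, -, -, hst⟩ := hstep i; exact hst) hsp hregR hdim
      hheight hvis (IsPosStep R P) (fun _ => Iff.rfl) (IsAncestorStep R P) (fun _ _ => Iff.rfl) J hJ hJA hJ2 hfin2 hinf'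
      (fun S S' _ _ hle hqt ξ hξ hspan f G F hf hG hF e he hlaw =>
        _root_.Summit.ResolutionOfSingularities.ResolutionOfSingularities.Theorems.SwitchingDichotomy.CleanerDescent.cleaner_descent
          2 hle hqt hξ hspan hf hG hF he hlaw)
  exact ⟨c, hc2, by omega, hK⟩

/-- **THE T-LINE OF RECORD AFTER Θ1♭** — `eternalSteeredRunTwo_of_slate6` with `hA3 := strippedThreadTwoN_holds`: T ⇐ **F-B ∧ F-A1 ∧ F-A2
(FRONTIER)** · **K♭(3) (FRONTIER; §σ2.26 reduction pending)** · D3a `LowTowerExistsTwo` (pv-012) · D3c `LowTowerTamingTwo` (062) · FACTS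
{Lipman 1978 (A), Cossart–Piltant 2019 (printed shape)}. Pure logic. OURS. [folklore] -/
theorem eternalSteeredRunTwo_of_slate6_closed
    (hS : StrippingTailHighConclTwoN) (hB₂ : BirthWanderHighConclTwoN) (hC₂ : BranchWanderHighConclTwoN)
    (hS3 : ∀ p : ℕ, p.Prime → NoEternalStrippedRadicandChain p 3)
    (hD3a : LowTowerExistsTwo) (hD3c : LowTowerTamingTwo)
    (hL' : Literature.AlgebraicGeometry.Resolution.Lipman1978NoEternalNormalisedBranch.{0})
    (hCP' : Literature.AlgebraicGeometry.Resolution.CossartPiltant2019LocalPermissible.{0}) : EternalSteeredRunTwo :=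
  eternalSteeredRunTwo_of_slate6 hS hB₂ hC₂ strippedThreadTwoN_holds hS3 hD3a hD3c hL' hCP'




/-! #### §σ2.26 v2 (re-cut r, plan-1 RULINGS 89/90) — the stripped-chain frontier in the DERIVATION currency (plan-1 RULINGS 84b / 86b–d;
NEW IMPORTS for the skeleton: `…Theorems.FrobeniusClosingSteerCleanedOrderMonotone` (res-type-096 p524779 ✓) and
`…Theorems.FrobeniusClosingSteerCleaningOptimalOfIsolated` (res-D-pv-011 p524687 ✓); res-type-096's step statement,
res-D-pv-011's (C) brick, res-L0-w41-idea-3's perfect/imperfect rung split, res-L0-w41-tri-2 v10 (R3); res-L0-w41-strat-2)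

K♭(c) `NoEternalStrippedRadicandChain` (v2.1, above) gains ONE MEMBER binder and becomes **K♭ v2.2** `NoEternalStrippedRadicandChainH`:
**H** `HasCleaningDerivations` («enough derivations»: an optimal cleaning of exact order `N` is SEEN by an absolute derivation — a
parameter direction of order `≤ N − 1` or a logarithmic direction of order `≤ N`; res-type-096's formula, RULING 84b; supplied for run germs
by (L7), res-D-pv-004; the regular-parameter property `x m ∉ 𝔪_(m+1)²` of tri-2 v10 (R3) is NOT a binder — it is derived from
the quadratic-transform clause by res-D-pv-011's `CleaningOptimal.excParam_mem_and_not_mem_sq`, plan-1 RULING 89). v2.1 ⇒ v2.2 trivially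
(`noEternalStrippedRadicandChainH_of`), so hS2's Lipman leaf re-derives. The (B2) step is res-type-096's **`DerivationStepTransfer`**,
DISCHARGED here by name (`derivationStepTransfer_holds` ← `CleanedOrderMonotone.exists_derivation_apply_not_mem_pow_succ_of_law`,
p524779 ✓), the (B1)/(C) step is **`CleaningExact`**, DISCHARGED here by name (`cleaningExact_holds` ← Q2
`QuadraticStep.mul_pow_mem_maximalIdeal_pow` along a Chevalley valuation ring + res-D-pv-011's `CleaningOptimal.cleaning_optimal_of_quadraticTransform`,
p524687 ✓, `2 < c`), and the PROVED reduction `noEternalStrippedRadicandChainH_of_constOrder` runs: (C) ⇒ `f m − (g m)^p` has exact order `p·e m` ⇒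
H gives `D` with `D (f m)` of exact order `ν ∈ {p·e m − 1, p·e m}` in the shape (B2) wants (derivations kill `p`-th powers and lower
`𝔪`-adic order by at most one — both proved here) ⇒ (B2) gives `D₁ (f (m+1)) ∉ 𝔪^(ν+1)` ⇒ with (C) at stage `m + 1`,
`p·e (m+1) − 1 ≤ ν ≤ p·e m` ⇒ `e (m+1) ≤ e m` (as `p ≥ 2`) ⇒ `e` eventually constant `= e∞ ≥ 2` ⇒ the tail is a CONSTANT-ORDER
isolated chain G(c, p·e∞) `NoEternalConstOrderIsolatedChain` (v2: the same member binder H), which splits by pure logic into the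
PERFECT-residue RUNG `…Perfect` (idea-3: (L2)–(L4), (Jμ-mono)) and the IMPERFECT residual `…Imperfect` (the WILD CORE W: quasi-square
initial forms, recurring purely inseparable residue steps; CP-II ch. 4 territory). The same reduction with the perfectness binder threaded
(`…HP_of_constOrder`) feeds F-B♮: the packaging Θ♮ `PointTailChainTwoN` lands in K♭ v2.2-PERFECT `NoEternalStrippedRadicandChainHP p 4`
(CoreDatum ⇒ ZeroDim + k perfect ⇒ perfect residue fields; tri-1 v6.9 / RULING 86b), so G-wild(4) stays OFF the T-line. F-A3 Θ1♭'s funnel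
`StrippedThreadTwoN` becomes `StrippedThreadTwoNH` (conclusion `¬ K♭ v2.2`: the packaged chain carries H = (L7); plan-1 RULING 90 (ii)); the
height-split assembly is re-run verbatim on the H-types (`highWanderConclTwoN_of_heightSplitH`, `eternalSteeredRunTwo_of_slate2H`) and
**`eternalSteeredRunTwo_of_slate7`** is the T-line candidate on r34 (12 binders): FRONTIER {F-A1 `hB₂`, F-A2 `hC₂`, F-B-wild `hFBw`,
G-TAME(4) `hG4`, W(3) `hW3`} · RUNG {G-perf(3) `hG3`} · WORK {Θ♮ `hΘ`, Θ1♭+(L7) `hA3`, D3a, D3c} · FACTS {hL′, hCP′} — (B2) and (C) are no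
longer binders. 0 new sorries. OURS; candidates, not refereed. -/

/-- A derivation lowers `I`-adic order by at most one: `δ(I^(N+1)) ⊆ I^N` (local copy of the tree's
`Derivation.apply_mem_pow_of_mem_pow_succ`, `…Theorems.FrobeniusClosingCampaignW41FormalTorsorLemmas` §1, to keep the skeleton's imports
unchanged). [folklore] -/
theorem derivation_apply_mem_pow_of_mem_pow_succ {A : Type} [CommRing A] (δ : Derivation ℤ A A) (I : Ideal A) :
    ∀ (N : ℕ) {a : A}, a ∈ I ^ (N + 1) → δ a ∈ I ^ N := by
  intro N
  induction N with
  | zero => intro a _; simp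
  | succ N ih =>
    intro a ha
    rw [pow_succ] at ha
    refine Submodule.mul_induction_on ha (fun y hy z hz => ?_) (fun x y hx hy => ?_)
    · rw [Derivation.leibniz, smul_eq_mul, smul_eq_mul]
      refine Ideal.add_mem _ (Ideal.mul_mem_right (δ z) _ hy) ?_
      rw [pow_succ']
      exact Ideal.mul_mem_mul hz (ih hy)
    · rw [map_add]; exact Ideal.add_mem _ hx hy

/-- Derivations of a subring of a characteristic-`p` field kill `p`-th powers (local copy of the tree's `JacAbs.derivation_subring_apply_pow`).
[folklore] -/
theorem derivation_subring_apply_pow_eq_zero {L : Type} [Field L] (p : ℕ) [CharP L p] (S₁ : Subring L)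
    (δ₁ : Derivation ℤ S₁ S₁) (y : S₁) : δ₁ (y ^ p) = 0 := by
  apply Subtype.ext
  rw [Derivation.leibniz_pow, nsmul_eq_mul]
  simp only [smul_eq_mul, Subring.coe_mul, Subring.coe_natCast, CharP.cast_eq_zero L p, zero_mul,
    Subring.coe_zero]

/-- **H · HasCleaningDerivations** — the MEMBER binder «enough derivations» (res-type-096's formula VERBATIM, plan-1 RULING 84b; tri-2 v10
(R1): the right literal shape): whenever `g` cleans `f` to EXACT order `N` (no `h` does better), some absolute derivation `D` of `S` sees
it — either `D f ∉ 𝔪^N` (a parameter direction) or `D` is logarithmic (`D 𝔪 ⊆ 𝔪`) with `D f ∉ 𝔪^(N+1)` (a coefficient direction).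
Holds for germs essentially of finite type over a perfect field ((L7), res-D-pv-004 `…SteerMemberDerivations`); may fail for abstract
excellent regular local rings with few derivations (accepted by design, tri-2 v10 (R2)). SUPPORT vocabulary. OURS. [folklore] -/
def HasCleaningDerivations (p : ℕ) {L : Type} [Field L] (S : Subring L) [IsLocalRing S] (f g : S) : Prop :=
  ∀ N : ℕ, (∀ h : S, f - h ^ p ∉ maximalIdeal S ^ (N + 1)) → f - g ^ p ∈ maximalIdeal S ^ N →
    ∃ D : Derivation ℤ S S, D f ∉ maximalIdeal S ^ N ∨
      ((∀ y ∈ maximalIdeal S, D y ∈ maximalIdeal S) ∧ D f ∉ maximalIdeal S ^ (N + 1))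

/-- **hB2 v2 · DerivationStepTransfer** (SUPPORT — res-type-096's STEP-LEVEL DERIVATION TRANSFER, plan-1 RULING 84b; tri-2 v10 PART 1: SOUND,
provable from regular + quadratic transform + span + law alone, any `p`, any `c`): along ONE step `S₀ ≤ S₁` of a stripped chain
(`𝔪₀·S₁ = (x₀)`, `x₀ ∉ 𝔪₁²`, `f₁·x₀^(p e₀) = f₀ − g₀^p`), if an absolute derivation `D` of `S₀` has `D f₀` of EXACT order `ν` and either
`p e₀ = ν + 1`, or `p e₀ = ν` and `D` is logarithmic, then some derivation `D₁` of `S₁` has `D₁ f₁ ∉ 𝔪₁^(ν+1)` (`D₁ := x_i·D` with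
`x_i S₁ = x₀ S₁`, `D₁ f₁ = unit·D f₀ / x₀^(p e₀ − 1)`; resp. `D₁ := D`, `D f₁ = D f₀ / x₀^(p e₀)`; the order of `h/x₀^ν` at `𝔪₁` is `≤ ν`
for `h` of exact order `ν`). Dimension / primality / `1 ≤ e₀` hypotheses are carried for uniformity and unused. PROVED below
(`derivationStepTransfer_holds`, res-type-096 p524779). OURS. [folklore] -/
def DerivationStepTransfer (p c : ℕ) : Prop :=
  ∀ (L : Type) [Field L] [CharP L p] (S₀ S₁ : Subring L) [IsLocalRing S₀] [IsLocalRing S₁] (h₀₁ : S₀ ≤ S₁)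
    (f₀ g₀ : S₀) (f₁ : S₁) (x₀ : S₁) (e₀ : ℕ), p.Prime → 1 ≤ e₀ →
    IsRegularLocalRing S₀ → IsRegularLocalRing S₁ →
    ringKrullDim S₀ = c → ringKrullDim S₁ = c →
    IsQuadraticTransform S₀ S₁ →
    Ideal.span ((fun y : S₀ => (⟨(y : L), h₀₁ y.2⟩ : S₁)) '' (maximalIdeal S₀ : Set S₀)) = Ideal.span {x₀} →
    ((f₁ : S₁) : L) * ((x₀ : S₁) : L) ^ (p * e₀) = ((f₀ : S₀) : L) - ((g₀ : S₀) : L) ^ p →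
    ∀ ν : ℕ, (∃ D : Derivation ℤ S₀ S₀, D f₀ ∈ maximalIdeal S₀ ^ ν ∧ D f₀ ∉ maximalIdeal S₀ ^ (ν + 1) ∧
        (p * e₀ = ν + 1 ∨ (p * e₀ = ν ∧ ∀ y ∈ maximalIdeal S₀, D y ∈ maximalIdeal S₀))) →
      ∃ D₁ : Derivation ℤ S₁ S₁, D₁ f₁ ∉ maximalIdeal S₁ ^ (ν + 1)

/-- **(C) · CleaningExact** (SUPPORT — «the full strip is exact», plan-1 RULINGS 66a/80/84b; res-type-096 §4 (C) / res-D-pv-011's brick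
`CleaningOptimal.cleaning_optimal_of_quadraticTransform` p524687 ✓; tri-2 v10 PART 1: CHECKED, needs `2 < c`): along one
step of a stripped chain in codimension `c ≥ 3`, with the next member of multiplicity `p` and ISOLATED, the cleaned element `f₀ − g₀^p` has
EXACT order `p e₀`: it lies in `𝔪₀^(p e₀)` (Q2: `x₀^n S₁ ∩ S₀ = 𝔪₀^n`, tree `QuadraticStep.mul_pow_mem_maximalIdeal_pow`) and no `h ∈ S₀`
cleans further (an under-strip `f₁ = x₀·u + q^p` is singular along a height-`≤ 2 < c` prime over `(x₀, u)` unless `u` is a unit, and then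
`hmult₁` puts `x₀ ∈ 𝔪₁^p ⊆ 𝔪₁²`). FALSE at `c = 2` (`f₀ = v³ + u⁷`): the guard is load-bearing. PROVED below (`cleaningExact_holds`).
OURS. [folklore] -/
def CleaningExact (p c : ℕ) : Prop :=
  2 < c → ∀ (L : Type) [Field L] [CharP L p] (S₀ S₁ : Subring L) [IsLocalRing S₀] [IsLocalRing S₁] (h₀₁ : S₀ ≤ S₁)
    (f₀ g₀ : S₀) (f₁ : S₁) (x₀ : S₁) (e₀ : ℕ), p.Prime → 1 ≤ e₀ →
    IsRegularLocalRing S₀ → IsRegularLocalRing S₁ → IsExcellentRing S₀ → IsExcellentRing S₁ →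
    ringKrullDim S₀ = c → ringKrullDim S₁ = c →
    IsQuadraticTransform S₀ S₁ →
    Ideal.span ((fun y : S₀ => (⟨(y : L), h₀₁ y.2⟩ : S₁)) '' (maximalIdeal S₀ : Set S₀)) = Ideal.span {x₀} →
    ((f₁ : S₁) : L) * ((x₀ : S₁) : L) ^ (p * e₀) = ((f₀ : S₀) : L) - ((g₀ : S₀) : L) ^ p →
    (∃ h : S₁, f₁ - h ^ p ∈ maximalIdeal S₁ ^ p) → HasIsolatedSingularity (RadicandRing S₁ p f₁) →
    f₀ - g₀ ^ p ∈ maximalIdeal S₀ ^ (p * e₀) ∧ ∀ h : S₀, f₀ - h ^ p ∉ maximalIdeal S₀ ^ (p * e₀ + 1)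

/-- **K♭ v2.2 · NoEternalStrippedRadicandChainH** (FRONTIER at `c = 3` modulo the pieces below; plan-1 RULINGS 84b/89): K♭ v2.1 VERBATIM with
ONE added member binder — H `HasCleaningDerivations p (S m) (f m) (g m)` after the multiplicity clause. Weaker than v2.1
(`noEternalStrippedRadicandChainH_of`). The F-A3 funnel's packaging (Θ1♭, res-D-pv-003) must now produce H for the transversal germs of the
run ((L7), res-D-pv-004; plan-1 RULING 90 (ii)). OURS. [cite: Lipman1978, Thm. p. 151]
[cite: CossartPiltant2019, Thm. 1.5 (i)] [folklore] -/
def NoEternalStrippedRadicandChainH (p c : ℕ) : Prop :=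
  ∀ (L : Type) [Field L] [CharP L p] (S : ℕ → Subring L) [∀ m, IsLocalRing (S m)]
    (hle : ∀ m, S m ≤ S (m + 1)) (f g : ∀ m, S m) (x : ∀ m, S (m + 1)) (e : ℕ → ℕ) (_he : ∀ m, 1 ≤ e m)
    (_hinf : ∀ m₀, ∃ m, m₀ ≤ m ∧ 2 ≤ e m),
    (∀ m, IsRegularLocalRing (S m)) → (∀ m, IsExcellentRing (S m)) → (∀ m, ringKrullDim (S m) = c) →
    (∀ m, IsQuadraticTransform (S m) (S (m + 1))) →
    (∀ m, Ideal.span ((fun y : S m => (⟨(y : L), hle m y.2⟩ : S (m + 1))) '' (maximalIdeal (S m) : Set (S m)))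
        = Ideal.span {x m}) →
    (∀ m, ((f (m + 1) : S (m + 1)) : L) * ((x m : S (m + 1)) : L) ^ (p * e m) =
        ((f m : S m) : L) - ((g m : S m) : L) ^ p) →
    (∀ m, ∃ h : S m, f m - h ^ p ∈ maximalIdeal (S m) ^ p) →
    (∀ m, HasCleaningDerivations p (S m) (f m) (g m)) →
    (∀ m, HasIsolatedSingularity (RadicandRing (S m) p (f m))) →
    False

/-- **K♭ v2.2 in the PERFECT-residue regime · NoEternalStrippedRadicandChainHP** (the currency of F-B♮'s packaging, plan-1 RULING 86b:
a `CoreDatum p 4` run has ZeroDim + `k` perfect, so every member's residue field is perfect): K♭ v2.2 with the extra member binder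
`PerfectField (ResidueField (S m))`. OURS. [folklore] -/
def NoEternalStrippedRadicandChainHP (p c : ℕ) : Prop :=
  ∀ (L : Type) [Field L] [CharP L p] (S : ℕ → Subring L) [∀ m, IsLocalRing (S m)]
    (hle : ∀ m, S m ≤ S (m + 1)) (f g : ∀ m, S m) (x : ∀ m, S (m + 1)) (e : ℕ → ℕ) (_he : ∀ m, 1 ≤ e m)
    (_hinf : ∀ m₀, ∃ m, m₀ ≤ m ∧ 2 ≤ e m),
    (∀ m, IsRegularLocalRing (S m)) → (∀ m, IsExcellentRing (S m)) → (∀ m, ringKrullDim (S m) = c) →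
    (∀ m, IsQuadraticTransform (S m) (S (m + 1))) →
    (∀ m, Ideal.span ((fun y : S m => (⟨(y : L), hle m y.2⟩ : S (m + 1))) '' (maximalIdeal (S m) : Set (S m)))
        = Ideal.span {x m}) →
    (∀ m, ((f (m + 1) : S (m + 1)) : L) * ((x m : S (m + 1)) : L) ^ (p * e m) =
        ((f m : S m) : L) - ((g m : S m) : L) ^ p) →
    (∀ m, ∃ h : S m, f m - h ^ p ∈ maximalIdeal (S m) ^ p) →
    (∀ m, HasCleaningDerivations p (S m) (f m) (g m)) →
    (∀ m, PerfectField (IsLocalRing.ResidueField (S m))) →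
    (∀ m, HasIsolatedSingularity (RadicandRing (S m) p (f m))) →
    False

/-- v2.1 ⇒ v2.2 (drop the member binder H). Pure logic. OURS. [folklore] -/
theorem noEternalStrippedRadicandChainH_of {p c : ℕ} (h : NoEternalStrippedRadicandChain p c) :
    NoEternalStrippedRadicandChainH p c :=
  fun L _ _ S _ hle f g x e he hinf hreg hexc hdim hqt hspan hlaw hmult _ hiso =>
    h L S hle f g x e he hinf hreg hexc hdim hqt hspan hlaw hmult hiso

/-- v2.2 ⇒ v2.2-perfect (drop the perfectness binder). Pure logic. OURS. [folklore] -/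
theorem noEternalStrippedRadicandChainHP_of {p c : ℕ} (h : NoEternalStrippedRadicandChainH p c) :
    NoEternalStrippedRadicandChainHP p c :=
  fun L _ _ S _ hle f g x e he hinf hreg hexc hdim hqt hspan hlaw hmult hH _ hiso =>
    h L S hle f g x e he hinf hreg hexc hdim hqt hspan hlaw hmult hH hiso

/-- **hS2 in the v2.2 currency** — K♭ v2.2 at `c = 2` from the Lipman leaf of record (`noEternalStrippedRadicandChain_two_of_lipmanNormalised`,
res-D-pv-014 p521063, RULING 68). OURS. [folklore] -/
theorem noEternalStrippedRadicandChainH_two_of_lipmanNormalised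
    (hL' : Literature.AlgebraicGeometry.Resolution.Lipman1978NoEternalNormalisedBranch.{0}) :
    ∀ p : ℕ, p.Prime → NoEternalStrippedRadicandChainH p 2 := fun p hp =>
  noEternalStrippedRadicandChainH_of (noEternalStrippedRadicandChain_two_of_lipmanNormalised hL' p hp)

/-- **G(c, d) v2 · NoEternalConstOrderIsolatedChain** (the constant-order isolated game; plan-1 RULINGS 66a/80/86c): K(c)'s binders with the
law at CONSTANT exponent `d` (`f (m+1) · (x m)^d = f m − (g m)^p`), every cleaning OPTIMAL (`f m − h^p ∉ 𝔪_m^(d+1)` for all `h`, so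
`d` is the exact cleaned order at every stage), isolated torsor singularity throughout, and (v2) the member binder H of K♭ v2.2
(the regular-parameter property `x m ∉ 𝔪_(m+1)²` is derivable: `CleaningOptimal.excParam_mem_and_not_mem_sq`). Only `d = p·e` is consumed downstream (res-L0-w41-tri-2 v10 N3; for `d < p` it is vacuous). Splits by residue-field perfectness (pure logic, below). Why it might fail:
this IS the dimension-`c+1` purely-inseparable endgame in its cleanest form (`c = 3`: Cossart–Piltant II ch. 4; `c = 4`: open). OURS.
[cite: CossartPiltant2019, Thm. 1.5 (i)] [folklore] -/
def NoEternalConstOrderIsolatedChain (p c d : ℕ) : Prop :=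
  ∀ (L : Type) [Field L] [CharP L p] (S : ℕ → Subring L) [∀ m, IsLocalRing (S m)]
    (hle : ∀ m, S m ≤ S (m + 1)) (f g : ∀ m, S m) (x : ∀ m, S (m + 1)),
    (∀ m, IsRegularLocalRing (S m)) → (∀ m, IsExcellentRing (S m)) → (∀ m, ringKrullDim (S m) = c) →
    (∀ m, IsQuadraticTransform (S m) (S (m + 1))) →
    (∀ m, Ideal.span ((fun y : S m => (⟨(y : L), hle m y.2⟩ : S (m + 1))) '' (maximalIdeal (S m) : Set (S m)))
        = Ideal.span {x m}) →
    (∀ m, ((f (m + 1) : S (m + 1)) : L) * ((x m : S (m + 1)) : L) ^ d =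
        ((f m : S m) : L) - ((g m : S m) : L) ^ p) →
    (∀ m, ∃ h : S m, f m - h ^ p ∈ maximalIdeal (S m) ^ p) →
    (∀ m (h : S m), f m - h ^ p ∉ maximalIdeal (S m) ^ (d + 1)) →
    (∀ m, HasCleaningDerivations p (S m) (f m) (g m)) →
    (∀ m, HasIsolatedSingularity (RadicandRing (S m) p (f m))) →
    False

/-- **G-perf(c, d) · NoEternalConstOrderIsolatedChainPerfect** (res-L0-w41-idea-3 RESULT-3 / Rung-g4 e1231d85b79a67be, plan-1 RULING 86c: the
RUNG — constant-order isolated chains whose members have PERFECT residue fields; attack lines (L2) «x persists», (L3) one smooth formal arc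
through the centres, (L4) `slope_bound` ⇒ the arc lies in the singular locus ✗ isolated; and (Jμ-mono) RULING 82). At `c = 4` this is the
TAME constant-order game G-TAME(4) of F-B♮ (RULING 86b/d). Why it might fail: (L2) when the pencil has rotated (tri-3 R-P). OURS. [folklore] -/
def NoEternalConstOrderIsolatedChainPerfect (p c d : ℕ) : Prop :=
  ∀ (L : Type) [Field L] [CharP L p] (S : ℕ → Subring L) [∀ m, IsLocalRing (S m)]
    (hle : ∀ m, S m ≤ S (m + 1)) (f g : ∀ m, S m) (x : ∀ m, S (m + 1)),
    (∀ m, IsRegularLocalRing (S m)) → (∀ m, IsExcellentRing (S m)) → (∀ m, ringKrullDim (S m) = c) →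
    (∀ m, IsQuadraticTransform (S m) (S (m + 1))) →
    (∀ m, Ideal.span ((fun y : S m => (⟨(y : L), hle m y.2⟩ : S (m + 1))) '' (maximalIdeal (S m) : Set (S m)))
        = Ideal.span {x m}) →
    (∀ m, ((f (m + 1) : S (m + 1)) : L) * ((x m : S (m + 1)) : L) ^ d =
        ((f m : S m) : L) - ((g m : S m) : L) ^ p) →
    (∀ m, ∃ h : S m, f m - h ^ p ∈ maximalIdeal (S m) ^ p) →
    (∀ m (h : S m), f m - h ^ p ∉ maximalIdeal (S m) ^ (d + 1)) →
    (∀ m, HasCleaningDerivations p (S m) (f m) (g m)) →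
    (∀ m, PerfectField (IsLocalRing.ResidueField (S m))) →
    (∀ m, HasIsolatedSingularity (RadicandRing (S m) p (f m))) →
    False

/-- **W(c, d) · NoEternalConstOrderIsolatedChainImperfect** (FRONTIER — the WILD CORE, plan-1 RULING 86c; res-L0-w41-idea-3's NAMED BREAK):
constant-order isolated chains with SOME member residue field imperfect (perfectness is constant along a chain of residually algebraic
steps, so: all of them) — quasi-square initial forms `Σ φ_α M_α²` (`φ_α ∉ κ²`), purely inseparable residue steps recurring, no formal arc.
Only treatment in print: Cossart–Piltant II ch. 4 (`c = 3`). Why it might fail: it is the residual of the residual. OURS.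
[cite: CossartPiltant2019, Thm. 1.5 (i)] [folklore] -/
def NoEternalConstOrderIsolatedChainImperfect (p c d : ℕ) : Prop :=
  ∀ (L : Type) [Field L] [CharP L p] (S : ℕ → Subring L) [∀ m, IsLocalRing (S m)]
    (hle : ∀ m, S m ≤ S (m + 1)) (f g : ∀ m, S m) (x : ∀ m, S (m + 1)),
    (∀ m, IsRegularLocalRing (S m)) → (∀ m, IsExcellentRing (S m)) → (∀ m, ringKrullDim (S m) = c) →
    (∀ m, IsQuadraticTransform (S m) (S (m + 1))) →
    (∀ m, Ideal.span ((fun y : S m => (⟨(y : L), hle m y.2⟩ : S (m + 1))) '' (maximalIdeal (S m) : Set (S m)))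
        = Ideal.span {x m}) →
    (∀ m, ((f (m + 1) : S (m + 1)) : L) * ((x m : S (m + 1)) : L) ^ d =
        ((f m : S m) : L) - ((g m : S m) : L) ^ p) →
    (∀ m, ∃ h : S m, f m - h ^ p ∈ maximalIdeal (S m) ^ p) →
    (∀ m (h : S m), f m - h ^ p ∉ maximalIdeal (S m) ^ (d + 1)) →
    (∀ m, HasCleaningDerivations p (S m) (f m) (g m)) →
    (¬ ∀ m, PerfectField (IsLocalRing.ResidueField (S m))) →
    (∀ m, HasIsolatedSingularity (RadicandRing (S m) p (f m))) →
    False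

/-- G(c, d) ⟸ G-perf(c, d) ∧ W(c, d) (res-L0-w41-idea-3's `noEternalConstOrderIsolatedChainI_of_perfect_of_imperfect`, renamed). Pure logic.
OURS. [folklore] -/
theorem noEternalConstOrderIsolatedChain_of_perfect_of_imperfect {p c d : ℕ}
    (hP : NoEternalConstOrderIsolatedChainPerfect p c d) (hW : NoEternalConstOrderIsolatedChainImperfect p c d) :
    NoEternalConstOrderIsolatedChain p c d := by
  intro L _ _ S _ hle f g x hreg hexc hdim hqt hspan hlaw hmult hopt hH hiso
  by_cases hperf : ∀ m, PerfectField (IsLocalRing.ResidueField (S m))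
  · exact hP L S hle f g x hreg hexc hdim hqt hspan hlaw hmult hopt hH hperf hiso
  · exact hW L S hle f g x hreg hexc hdim hqt hspan hlaw hmult hopt hH hperf hiso

/-- The two weakenings (for owners who prove G outright). Pure logic. OURS. [folklore] -/
theorem noEternalConstOrderIsolatedChainPerfect_of {p c d : ℕ} (h : NoEternalConstOrderIsolatedChain p c d) :
    NoEternalConstOrderIsolatedChainPerfect p c d :=
  fun L _ _ S _ hle f g x hreg hexc hdim hqt hspan hlaw hmult hopt hH _ hiso =>
    h L S hle f g x hreg hexc hdim hqt hspan hlaw hmult hopt hH hiso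

/-- See `noEternalConstOrderIsolatedChainPerfect_of`. Pure logic. OURS. [folklore] -/
theorem noEternalConstOrderIsolatedChainImperfect_of {p c d : ℕ} (h : NoEternalConstOrderIsolatedChain p c d) :
    NoEternalConstOrderIsolatedChainImperfect p c d :=
  fun L _ _ S _ hle f g x hreg hexc hdim hqt hspan hlaw hmult hopt hH _ hiso =>
    h L S hle f g x hreg hexc hdim hqt hspan hlaw hmult hopt hH hiso

end SteeredTwo

end Summit.ResolutionOfSingularities.ResolutionOfSingularities.Theorems.SwitchingDichotomy.Words
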